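import Literature.AlgebraicGeometry.HodgeTheory.HomComplexExact
import Mathlib.Algebra.BigOperators.Group.Finset.Basic
import Mathlib.Algebra.Order.Interval.Finset.Basic
import Mathlib.Data.Int.Interval

/-!
# The unit `𝒪_X[0] ⟶ 𝓗om•(E•, E•)` of a bounded cochain complex of `𝒪_X`-modules

PROMOTED LITERATURE COPY (librarian protocol (b); DEFREQ-CoherentISemiregular, cell pub-hsemireg) of the generic, conjecture-free
`Summits/Ventures/HSemireg/HomComplexUnit.lean` — namespace now `Literature.AlgebraicGeometry.HodgeTheory`, names kept; cell words (seats, ventures) = provenance.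

For a cochain complex `E•` of `𝒪_X`-modules concentrated in degrees `[a, b]`, the global section
`Σ_p 𝟙_{E^p}` of `𝓗om•(E•, E•)^0 = ∐_p 𝓔nd(E^p)` is a `0`-cocycle for the Hom-complex differential
`ψ ↦ ψ ≫ d_E + (-1)^{n+1} d_E ≫ ψ` (the two boundary terms of each `𝟙_{E^p}` cancel telescopically), hence a chain map
`unit : 𝒪_X[0] ⟶ 𝓗om•(E•, E•)` (`HomologicalComplex.mkHomFromSingle`).  This is the morphism through which an
element of `Ext^n(E•, E•) = Hom_{D(X)}(E•, E•[n])` is turned into a hypercohomology class of `𝓗om•(E•, E•)`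
(precomposition with `Q(unit)`), the first arrow of the semiregularity map of a perfect complex.
[cite: BuchweitzFlenner2003, §2 and Def. 4.1] — kernel plumbing on real carriers; no statement about any conjecture.

Contents: §1 compatibilities of the section map `unitToSheafHom f : 𝒪_X ⟶ 𝓗om(E, M)` with post- and pre-composition
(`unitToSheafHom_comp_sheafHomMap`, `unitToSheafHom_comp_sheafHomMapLeft`, `sheafHomUnit_comp_sheafHomMap(Left)`,
`unitToSheafHom_zero`); §2 the summands `unitSummand`, their differentials `unitSummand_d = δ(i) - δ(i+1)`, the cocycle
`unitDeg₀_d` and the chain map `HomComplex.unit X E a b`; §3 naturality of the unit under a chain map `f : E• ⟶ E'•`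
(`unit_comp_map_eq_unit_comp_premap`: both composites `𝒪_X[0] ⟶ 𝓗om•(E•, E'•)` are «the section `f`»), the
ingredient of the invariance of the semiregularity map under isomorphisms of complexes.
-/

noncomputable section

open CategoryTheory CategoryTheory.Limits AlgebraicGeometry Opposite

universe u

namespace Literature.AlgebraicGeometry.HodgeTheory

open Literature.AlgebraicGeometry.Modules Literature.AlgebraicGeometry.Motives

/-! ## §1 The section map `𝒪_X ⟶ 𝓗om(E, M)` and composition -/

section UnitLemmas

variable {X : Scheme.{u}} {E M N : X.Modules}

/-- `(section f) ≫ 𝓗om(E, g) = section (f ≫ g)`. [cite: Hartshorne1977, II §5 (sheaf Hom, p. 109)] -/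
lemma unitToSheafHom_comp_sheafHomMap (f : E ⟶ M) (g : M ⟶ N) :
    unitToSheafHom f ≫ sheafHomMap E g = unitToSheafHom (f ≫ g) := by
  refine Scheme.Modules.hom_ext _ _ fun U => AddCommGrpCat.ext fun (a : Γ(unitModule X, U)) => ?_
  change (sheafHomMap E g).app U ((unitToSheafHom f).app U a) = (unitToSheafHom (f ≫ g)).app U a
  rw [unitToSheafHom_app_apply, unitToSheafHom_app_apply, sheafHomMap_app_apply]
  refine hom_ext_of_appLE fun W k s => ?_
  rw [appLE_comp, appLE_smul, appLE_smul, appLE_over_map, appLE_over_map, appLE_over_map,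
    Scheme.Modules.Hom.app_smul, Scheme.Modules.Hom.comp_app]
  rfl

/-- `(section g) ≫ 𝓗om(f, N) = section (f ≫ g)`. [cite: Hartshorne1977, II §5 (sheaf Hom, p. 109)] -/
lemma unitToSheafHom_comp_sheafHomMapLeft (f : E ⟶ M) (g : M ⟶ N) :
    unitToSheafHom g ≫ sheafHomMapLeft f N = unitToSheafHom (f ≫ g) := by
  refine Scheme.Modules.hom_ext _ _ fun U => AddCommGrpCat.ext fun (a : Γ(unitModule X, U)) => ?_
  change (sheafHomMapLeft f N).app U ((unitToSheafHom g).app U a) = (unitToSheafHom (f ≫ g)).app U a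
  rw [unitToSheafHom_app_apply, unitToSheafHom_app_apply, sheafHomMapLeft_app_apply]
  refine hom_ext_of_appLE fun W k s => ?_
  rw [appLE_comp, appLE_smul, appLE_smul, appLE_over_map, appLE_over_map, appLE_over_map,
    Scheme.Modules.Hom.comp_app]
  rfl

/-- The unit followed by post-composition with `f` is the section `f`: `(a ↦ a·𝟙) ≫ 𝓗om(E, f) = (a ↦ a·f)`. [cite: Hartshorne1977, II §5 (sheaf Hom, p. 109)] -/
lemma sheafHomUnit_comp_sheafHomMap (f : E ⟶ M) : sheafHomUnit E ≫ sheafHomMap E f = unitToSheafHom f := by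
  rw [sheafHomUnit, unitToSheafHom_comp_sheafHomMap, Category.id_comp]

/-- The unit followed by pre-composition with `f` is the section `f`: `(a ↦ a·𝟙) ≫ 𝓗om(f, M) = (a ↦ a·f)`. [cite: Hartshorne1977, II §5 (sheaf Hom, p. 109)] -/
lemma sheafHomUnit_comp_sheafHomMapLeft (f : E ⟶ M) :
    sheafHomUnit M ≫ sheafHomMapLeft f M = unitToSheafHom f := by
  rw [sheafHomUnit, unitToSheafHom_comp_sheafHomMapLeft, Category.comp_id]

/-- The section map of the zero morphism is zero. [cite: Hartshorne1977, II §5 (sheaf Hom, p. 109)] -/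
lemma unitToSheafHom_zero : unitToSheafHom (0 : E ⟶ M) = 0 := by
  refine Scheme.Modules.hom_ext _ _ fun U => AddCommGrpCat.ext fun (a : Γ(unitModule X, U)) => ?_
  rw [unitToSheafHom_app_apply, Scheme.Modules.Hom.zero_app]
  refine hom_ext_of_appLE fun W k s => ?_
  rw [appLE_smul, appLE_over_map, Scheme.Modules.Hom.zero_app]
  change _ • (0 : Γ(M, W)) = appLE (0 : E.over U ⟶ M.over U) k s
  rw [smul_zero, appLE_zero]

end UnitLemmas

/-! ## §2 The unit of a bounded complex -/

namespace HomComplex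

section Unit

variable (X : Scheme.{u}) (E : CochainComplex X.Modules ℤ) (a b : ℤ)

/-- The unit summand `𝒪_X ⟶ 𝓔nd(E^{-i}) ⟶ 𝓗om•(E•, E•)^0` (summand `(-i, i)`). [folklore] -/
def unitSummand (i : ℤ) : unitModule X ⟶ (homComplex X E E).X 0 :=
  sheafHomUnit (E.X (-i)) ≫ ι X E E (-i) i 0 (by lia)

/-- The degree-`0` unit `Σ_{i ∈ [-b, -a]} (a ↦ a · 𝟙_{E^{-i}})`. [folklore] -/
def unitDeg₀ : unitModule X ⟶ (homComplex X E E).X 0 := ∑ i ∈ Finset.Icc (-b) (-a), unitSummand X E i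

/-- The packaged degree-`1` term `(section of d_E : E^{-j} → E^q) ≫ ι (q, j)` (to transport along `q = q'`). [folklore] -/
def unitTerm (j q : ℤ) (h : q + j = 1) : unitModule X ⟶ (homComplex X E E).X 1 :=
  unitToSheafHom (E.d (-j) q) ≫ ι X E E q j 1 h

/-- Transport of `unitTerm` along an equality of the target degree. [cite: Weibel1994, 2.7.4–2.7.5 (Hom cochain complex)] -/
lemma unitTerm_congr {j q q' : ℤ} (e : q = q') (h : q + j = 1) (h' : q' + j = 1) :
    unitTerm X E j q h = unitTerm X E j q' h' := by subst e; rfl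

/-- `δ(i) = (section of d_E^{-i}) ≫ ι (-i+1, i)`. [folklore] -/
def unitδ (i : ℤ) : unitModule X ⟶ (homComplex X E E).X 1 := unitTerm X E i (-i + 1) (by lia)

/-- `δ(i) = 0` when the source term `E^{-i}` vanishes. [cite: Weibel1994, 2.7.4–2.7.5 (Hom cochain complex)] -/
lemma unitδ_eq_zero_of_src (i : ℤ) (h : IsZero (E.X (-i))) : unitδ X E i = 0 := by
  change unitToSheafHom (E.d (-i) (-i + 1)) ≫ _ = 0
  rw [h.eq_of_src (E.d (-i) (-i + 1)) 0, unitToSheafHom_zero (X := X), zero_comp]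

/-- `δ(i) = 0` when the target term `E^{-i+1}` vanishes. [cite: Weibel1994, 2.7.4–2.7.5 (Hom cochain complex)] -/
lemma unitδ_eq_zero_of_tgt (i : ℤ) (h : IsZero (E.X (-i + 1))) : unitδ X E i = 0 := by
  change unitToSheafHom (E.d (-i) (-i + 1)) ≫ _ = 0
  rw [h.eq_of_tgt (E.d (-i) (-i + 1)) 0, unitToSheafHom_zero (X := X), zero_comp]

/-- `F`-direction on the unit summand: `d ∘ 𝟙 = d`. [cite: Weibel1994, 2.7.4–2.7.5 (Hom cochain complex)] -/
lemma unitSummand_D₁ (i : ℤ) :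
    unitSummand X E i ≫ HomologicalComplex.mapBifunctor.D₁ E (dualComplex X E) (sheafHomBifunctor X).flip
      (ComplexShape.up ℤ) 0 1 = unitδ X E i := by
  change (sheafHomUnit (E.X (-i)) ≫ ι X E E (-i) i 0 _) ≫ _ = _
  rw [Category.assoc, ι_D₁ X E E (-i) i 0 1 (by lia) (by lia), ← Category.assoc, sheafHomUnit_comp_sheafHomMap]
  rfl

/-- `E`-direction on the unit summand: `-(𝟙 ∘ d) = -d`, landing in the summand of `δ(i+1)`. [cite: Weibel1994, 2.7.4–2.7.5 (Hom cochain complex)] -/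
lemma unitSummand_D₂ (i : ℤ) :
    unitSummand X E i ≫ HomologicalComplex.mapBifunctor.D₂ E (dualComplex X E) (sheafHomBifunctor X).flip
      (ComplexShape.up ℤ) 0 1 = -unitδ X E (i + 1) := by
  change (sheafHomUnit (E.X (-i)) ≫ ι X E E (-i) i 0 _) ≫ _ = _
  rw [Category.assoc, ι_D₂ X E E (-i) i 0 1 (by lia) (by lia), Linear.comp_units_smul, ← Category.assoc,
    sheafHomUnit_comp_sheafHomMapLeft, zero_add, Int.negOnePow_one, Units.neg_smul, one_smul]
  exact congrArg Neg.neg (unitTerm_congr X E (by lia) _ _)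

/-- The differential of the unit summand telescopes: `δ(i) - δ(i+1)`. [cite: Weibel1994, 2.7.4–2.7.5 (Hom cochain complex)] -/
lemma unitSummand_d (i : ℤ) :
    unitSummand X E i ≫ (homComplex X E E).d 0 1 = unitδ X E i - unitδ X E (i + 1) := by
  rw [HomologicalComplex.mapBifunctor.d_eq, Preadditive.comp_add, unitSummand_D₁, unitSummand_D₂, sub_eq_add_neg]

variable [E.IsStrictlyGE a] [E.IsStrictlyLE b]

/-- **The degree-`0` unit is a cocycle** (this is where the sign convention of `homComplex` matters). [cite: Weibel1994, 2.7.4–2.7.5 (Hom cochain complex)] -/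
theorem unitDeg₀_d : unitDeg₀ X E a b ≫ (homComplex X E E).d 0 1 = 0 := by
  rw [unitDeg₀, Preadditive.sum_comp]
  simp_rw [unitSummand_d]
  rw [Finset.sum_sub_distrib, sub_eq_zero]
  -- both sums equal the sum of `δ` over the superset `[-b, -a + 1]`
  have h₁ : ∑ i ∈ Finset.Icc (-b) (-a), unitδ X E i = ∑ i ∈ Finset.Icc (-b) (-a + 1), unitδ X E i :=
    Finset.sum_subset (Finset.Icc_subset_Icc le_rfl (by lia)) fun j hj hj' => by
      obtain rfl : j = -a + 1 := by simp only [Finset.mem_Icc] at hj hj'; lia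
      exact unitδ_eq_zero_of_src X E _ (E.isZero_of_isStrictlyGE a _ (by lia))
  have h₂ : ∑ i ∈ Finset.Icc (-b) (-a), unitδ X E (i + 1) = ∑ i ∈ Finset.Icc (-b) (-a + 1), unitδ X E i := by
    rw [← Finset.sum_image (s := Finset.Icc (-b) (-a)) (g := (· + 1)) (f := unitδ X E)
      (fun x _ y _ h => by simpa using h), Finset.image_add_right_Icc]
    exact Finset.sum_subset (Finset.Icc_subset_Icc (by lia) le_rfl) fun j hj hj' => by
      obtain rfl : j = -b := by simp only [Finset.mem_Icc] at hj hj'; lia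
      exact unitδ_eq_zero_of_tgt X E _ (E.isZero_of_isStrictlyLE b _ (by lia))
  rw [h₁, h₂]

/-- **The unit** `𝒪_X[0] ⟶ 𝓗om•(E•, E•)` of a complex `E• ∈ [a, b]`: `a ↦ Σ_p a · 𝟙_{E^p}`, a chain map because
`Σ_p 𝟙_{E^p}` is a `0`-cocycle for the Hom-complex differential `ψ ↦ ψ ≫ d + (-1)^{n+1} d ≫ ψ`. [folklore] -/
def unit : (HomologicalComplex.single X.Modules (ComplexShape.up ℤ) 0).obj (unitModule X) ⟶ homComplex X E E :=
  HomologicalComplex.mkHomFromSingle (unitDeg₀ X E a b) fun k hk => by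
    obtain rfl : k = 1 := by simp at hk; lia
    exact unitDeg₀_d X E a b

/-! ## §3 Naturality of the unit -/

omit [E.IsStrictlyGE a] [E.IsStrictlyLE b] in
/-- On each summand, post-composing the unit of `E•` with `f` and pre-composing the unit of `E'•` with `f` agree:
both are the section `f^{-i}` of `𝓗om(E^{-i}, E'^{-i})`. [cite: Weibel1994, 2.7.4–2.7.5 (Hom cochain complex)] -/
lemma unitSummand_comp_map_eq (E' : CochainComplex X.Modules ℤ) (f : E ⟶ E') (i : ℤ) :
    unitSummand X E i ≫ (map X E f).f 0 = unitSummand X E' i ≫ (premap X f E').f 0 := by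
  change (sheafHomUnit (E.X (-i)) ≫ ι X E E (-i) i 0 _) ≫ _ = (sheafHomUnit (E'.X (-i)) ≫ ι X E' E' (-i) i 0 _) ≫ _
  rw [Category.assoc, Category.assoc, ι_map X E f (-i) i 0 (by lia), ι_premap X f E' (-i) i 0 (by lia),
    ← Category.assoc, ← Category.assoc, sheafHomUnit_comp_sheafHomMap, sheafHomUnit_comp_sheafHomMapLeft]

/-- **Naturality of the unit.** For a chain map `f : E• ⟶ E'•` between complexes in `[a, b]`,
`unit(E•) ≫ 𝓗om•(E•, f) = unit(E'•) ≫ 𝓗om•(f, E'•) : 𝒪_X[0] ⟶ 𝓗om•(E•, E'•)` — both send `1` to `Σ_p f^p`.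
(For an isomorphism `f` this is the first step of `σ(E•) ∘ Ad(f) = σ(E'•)`.) [cite: Weibel1994, 2.7.4–2.7.5 (Hom cochain complex)] -/
theorem unit_comp_map_eq_unit_comp_premap (E' : CochainComplex X.Modules ℤ) [E'.IsStrictlyGE a] [E'.IsStrictlyLE b]
    (f : E ⟶ E') : unit X E a b ≫ map X E f = unit X E' a b ≫ premap X f E' := by
  refine HomologicalComplex.from_single_hom_ext ?_
  rw [HomologicalComplex.comp_f, HomologicalComplex.comp_f, unit, unit, HomologicalComplex.mkHomFromSingle_f,
    HomologicalComplex.mkHomFromSingle_f, Category.assoc, Category.assoc, unitDeg₀, unitDeg₀, Preadditive.sum_comp,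
    Preadditive.sum_comp]
  exact congrArg _ (Finset.sum_congr rfl fun i _ => unitSummand_comp_map_eq X E E' f i)

end Unit

end HomComplex

end Literature.AlgebraicGeometry.HodgeTheory

end
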